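import Summits.QuantumFields.BalabanUV.T4Continuum.Support.NE7K1LinHomTrial

/-!
# NE7K1LinHomKernel — row NE7 (node U5), candidate route HOM, path H1L, cell K1-lin(s): THE ONE-DIMENSIONAL QUADRATIC INTERPOLATION
# KERNEL of the homogenised lift — exact block means, partition of unity, Abel's identity for its bond differences

Lineage `b2b-balaban-t4-ne7-p2` (CRUX PROVER NE7 #2), generation 66 (second file of the L-UNIFORM upper two-run constant; g65 OPEN
item (4)(ii); lens 2's number (K2)♯-U `ρ(L) = 3L²∕(L²+2) ↑ 3`, t4-ne7-idea-2 g35).  The block-constant lift behind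
`NE7K1LinTwoRunFaces.schurB_form_le_sharp` (constant `L`) concentrates the coarse gradient on the block faces; the lift of the next
files spreads it over the block with the kernel of THIS file.  In one dimension, coarse sites `Y`, fine sites `t = LX + j`
(`0 ≤ j < L`), all [folklore]:

* §1 the shape `ℓ_j = (L² − 2L(2j+1) + 3j(j+1) + 1)∕L²` (the discrete parabola `(1−y)(1−3y) + 1∕(4L²)` at `y = (j+½)∕L`), its
  mirror `r_j = ℓ_{L−1−j}`; `Σ_{j<L} ℓ_j = Σ_{j<L} r_j = 0` (`sum_shapeL`, `sum_shapeR`; Faulhaber to degree 2).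
* §2 bounds: `−1∕3 ≤ ℓ_j ≤ 1`, `ℓ_j + r_j ≥ −1∕2`, increments `ℓ_{j+1} − ℓ_j = (6j+6−4L)∕L²`, `r_{j+1} − r_j = (6j+6−2L)∕L²`,
  `1 − ℓ_0 = (2L−1)∕L²`, `ℓ_{L−1} = (1−L)∕L²` — every increment is `O(1∕L)`: the gradient is spread over the block.
* §3 the CUMULATIVE profile `Ω` (`cumK`: `1`, `1 − r∕2`, `ℓ∕2`, `0` on consecutive blocks), the cumulative FOLDED kernel `cumF` on
  a coarse segment `[0,N)` (reflected neighbours folded onto the end sites), the interpolation kernel `k̃(t,Y) = cum(t,Y) − cum(t,Y−1)`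
  (`kerF`) and the bond kernel `b(t,Y) = cum(t+1,Y) − cum(t,Y)` (`bondF`); PARTITION OF UNITY `Σ_Y k̃(t,Y) = 1` (`sum_kerF`,
  telescoping), ABEL'S IDENTITY `k̃(t+1,Y) − k̃(t,Y) = b(t,Y) − b(t,Y−1)` (`kerF_succ_sub`) with `b(t,−1) = b(t,N−1) = 0`, the values
  of `cum` block by block, and the EXACT BLOCK MEANS `Σ_{j<L} k̃(LX+j, Y) = L·[X = Y]` (`sum_kerF_block`).

The absolute row ∕ column sums (Schur-test constants `ρ₀ = 3∕2`, `ρ₁ = 5∕3`, `α₀ = 3`, `α₁ = 5∕3`) are `NE7K1LinHomKernelSums` ∕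
`NE7K1LinHomKernelBond`.

HONEST FRAMING: elementary real analysis of ONE explicit piecewise-quadratic kernel on `ℤ` ([folklore]); no lattice field, no
operator of Bałaban's; it serves the homogenised upper two-run constant of `NE7K1LinHomUpper` (Gaussian `A = 0`, one RG step,
`U = 1`).  FIXED FINITE T⁴, rung (B)+1; NE7 NOT PRINTED ∕ NOT PROVED; spine 0∕9; NOT infinite volume, NOT mass gap, NOT Clay.  HONEST
DEPENDENCY: continuum YM on T⁴ ⇐ BetaPertH ∧ nine spine estimates (0/9 proved); BetaPertH ⇐ (D1) ∧ (D4) ∧ CAP+tail; G-an2-4 gates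
asym, D1 and NE2/3/4.
-/

noncomputable section

open Finset

namespace Summit.QuantumFields.BalabanUV.T4Continuum.NE7K1LinHomKernel

/-! ### §1 The one-dimensional shape and its sums -/

/-- the LEFT shape `ℓ_j = (L² − 2L(2j+1) + 3j(j+1) + 1)∕L²` (a discrete parabola; `Σ_{j<L} ℓ_j = 0`, `ℓ_0 = (L−1)²∕L²`,
`ℓ_{L−1} = (1−L)∕L²`). [folklore] -/
def shapeL (L : ℕ) (j : ℤ) : ℝ := ((L : ℝ) ^ 2 - 2 * L * (2 * j + 1) + 3 * j * (j + 1) + 1) / (L : ℝ) ^ 2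

/-- the RIGHT shape `r_j = ℓ_{L−1−j}`. [folklore] -/
def shapeR (L : ℕ) (j : ℤ) : ℝ := shapeL L ((L : ℤ) - 1 - j)

/-- **EXACT MEANS**: `Σ_{j<L} ℓ_j = 0` (Faulhaber: `Σ_{j<L}(2j+1) = L²`, `Σ_{j<L} 3j(j+1) = (L−1)L(L+1)`). [folklore] -/
theorem sum_shapeL (L : ℕ) : ∑ j ∈ range L, shapeL L (j : ℤ) = 0 := by
  have sum_range_two_mul_add_one : ∀ K : ℕ, ∑ j ∈ range K, (2 * (j : ℝ) + 1) = (K : ℝ) ^ 2 := by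
    intro K
    induction K with
    | zero => simp
    | succ K ih => rw [sum_range_succ, ih]; push_cast; ring
  have sum_range_three_mul : ∀ K : ℕ, ∑ j ∈ range K, (3 * (j : ℝ) * (j + 1)) = ((K : ℝ) - 1) * K * (K + 1) := by
    intro K
    induction K with
    | zero => simp
    | succ K ih => rw [sum_range_succ, ih]; push_cast; ring
  unfold shapeL
  rw [← Finset.sum_div]
  have h : ∑ j ∈ range L, ((L : ℝ) ^ 2 - 2 * L * (2 * ((j : ℕ) : ℤ) + 1) + 3 * ((j : ℕ) : ℤ) * (((j : ℕ) : ℤ) + 1) + 1) =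
      (L : ℝ) * (L : ℝ) ^ 2 - 2 * L * ∑ j ∈ range L, (2 * (j : ℝ) + 1) + ∑ j ∈ range L, (3 * (j : ℝ) * (j + 1)) + L := by
    rw [Finset.mul_sum]
    simp only [Int.cast_natCast, Finset.sum_add_distrib, Finset.sum_sub_distrib, Finset.sum_const, Finset.card_range,
      nsmul_eq_mul, mul_one]
  rw [h, sum_range_two_mul_add_one, sum_range_three_mul]
  ring_nf

/-- `Σ_{j<L} r_j = 0`. [folklore] -/
theorem sum_shapeR (L : ℕ) : ∑ j ∈ range L, shapeR L (j : ℤ) = 0 := by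
  have h : ∀ j ∈ range L, shapeR L (j : ℤ) = shapeL L ((L - 1 - j : ℕ) : ℤ) := by
    intro j hj
    rw [Finset.mem_range] at hj
    unfold shapeR
    congr 1
    omega
  rw [Finset.sum_congr rfl h, Finset.sum_range_reflect (fun j => shapeL L (j : ℤ)) L, sum_shapeL]

/-! ### §2 Bounds on the shape -/

section Bounds

variable {L : ℕ} {j : ℤ}

/-- `ℓ_j ≤ 1` on `0 ≤ j < L`. [folklore] -/
theorem shapeL_le_one (hL : 1 ≤ L) (hj0 : 0 ≤ j) (hjL : j < L) : shapeL L j ≤ 1 := by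
  unfold shapeL
  have hLr : (1 : ℝ) ≤ L := by exact_mod_cast hL
  have hj0r : (0 : ℝ) ≤ j := by exact_mod_cast hj0
  have hjLr : (j : ℝ) + 1 ≤ L := by
    have : j + 1 ≤ (L : ℤ) := by omega
    exact_mod_cast this
  rw [div_le_one (by positivity)]
  nlinarith

/-- `ℓ_j ≥ −1∕3` (everywhere: `36·(3ℓ_j + 1)L² = … = (4L − 6j − 3)² + 3 > 0`). [folklore] -/
theorem shapeL_ge (hL : 1 ≤ L) : -(1 / 3 : ℝ) ≤ shapeL L j := by
  unfold shapeL
  have hLr : (1 : ℝ) ≤ L := by exact_mod_cast hL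
  have hL2 : (0 : ℝ) < (L : ℝ) ^ 2 := by positivity
  rw [le_div_iff₀ hL2]
  nlinarith [sq_nonneg (4 * (L : ℝ) - 6 * j - 3)]

/-- `r_j ≤ 1` on `0 ≤ j < L`. [folklore] -/
theorem shapeR_le_one (hL : 1 ≤ L) (hj0 : 0 ≤ j) (hjL : j < L) : shapeR L j ≤ 1 :=
  shapeL_le_one hL (by omega) (by omega)

/-- `r_j ≥ −1∕3`. [folklore] -/
theorem shapeR_ge (hL : 1 ≤ L) : -(1 / 3 : ℝ) ≤ shapeR L j := shapeL_ge hL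

/-- `ℓ_j + r_j ≥ −1∕2` (`2L²(ℓ_j + r_j) + L² = 3(2j + 1 − L)² + 1 > 0`). [folklore] -/
theorem shapeL_add_shapeR_ge (hL : 1 ≤ L) : -(1 / 2 : ℝ) ≤ shapeL L j + shapeR L j := by
  unfold shapeR shapeL
  have hLr : (1 : ℝ) ≤ L := by exact_mod_cast hL
  have hL2 : (0 : ℝ) < (L : ℝ) ^ 2 := by positivity
  rw [← add_div, le_div_iff₀ hL2]
  push_cast
  nlinarith [sq_nonneg (2 * (j : ℝ) + 1 - L)]

/-- the increment of the left shape: `ℓ_{j+1} − ℓ_j = (6j + 6 − 4L)∕L²`. [folklore] -/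
theorem shapeL_succ_sub (hL : 1 ≤ L) (j : ℤ) : shapeL L (j + 1) - shapeL L j = (6 * j + 6 - 4 * L) / (L : ℝ) ^ 2 := by
  unfold shapeL
  have hL0 : (L : ℝ) ≠ 0 := Nat.cast_ne_zero.2 (by omega)
  field_simp
  push_cast
  ring

/-- the increment of the right shape: `r_{j+1} − r_j = (6j + 6 − 2L)∕L²`. [folklore] -/
theorem shapeR_succ_sub (hL : 1 ≤ L) (j : ℤ) : shapeR L (j + 1) - shapeR L j = (6 * j + 6 - 2 * L) / (L : ℝ) ^ 2 := by
  unfold shapeR shapeL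
  have hL0 : (L : ℝ) ≠ 0 := Nat.cast_ne_zero.2 (by omega)
  field_simp
  push_cast
  ring

/-- `ℓ_0 = (L−1)²∕L²`, so `1 − ℓ_0 = (2L−1)∕L²`. [folklore] -/
theorem one_sub_shapeL_zero (hL : 1 ≤ L) : 1 - shapeL L 0 = (2 * L - 1) / (L : ℝ) ^ 2 := by
  unfold shapeL
  have hL0 : (L : ℝ) ≠ 0 := Nat.cast_ne_zero.2 (by omega)
  field_simp
  ring

/-- `ℓ_{L−1} = (1−L)∕L²`. [folklore] -/
theorem shapeL_last (hL : 1 ≤ L) : shapeL L ((L : ℤ) - 1) = (1 - L) / (L : ℝ) ^ 2 := by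
  unfold shapeL
  have hL0 : (L : ℝ) ≠ 0 := Nat.cast_ne_zero.2 (by omega)
  push_cast
  field_simp
  ring

end Bounds


/-! ### §3 The cumulative profile, the folded kernel on a coarse segment `[0,N)`, the bond kernel -/

/-- the CUMULATIVE PROFILE `Ω(s) = Σ_{m ≥ 0} w(s + mL)` of the interpolation kernel `w`: `1` left of the block, `1 − r_s∕2` on the
block `[0,L)`, `ℓ_{s−L}∕2` on the next block, `0` beyond. [folklore] -/
def cumK (L : ℕ) (s : ℤ) : ℝ :=
  if s < 0 then 1 else if s < L then 1 - shapeR L s / 2 else if s < 2 * L then shapeL L (s - L) / 2 else 0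

/-- the CUMULATIVE FOLDED KERNEL on the coarse segment `[0,N)`: `cum(t, Y) = Σ_{Y′ ≤ Y} k̃(t, Y′)` — `0` below the segment,
`Ω(t − LY)` inside, `1` from the last coarse site on (the reflected neighbours `Y′ = −1`, `Y′ = N` are folded onto `0`, `N−1`).
[folklore] -/
def cumF (N L : ℕ) (t Y : ℤ) : ℝ :=
  if Y < 0 then 0 else if Y + 1 < N then cumK L (t - L * Y) else 1

/-- **THE FOLDED INTERPOLATION KERNEL** `k̃(t, Y) = cum(t, Y) − cum(t, Y−1)` for fine sites `0 ≤ t < NL` (zero outside the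
fine segment). [folklore] -/
def kerF (N L : ℕ) (t Y : ℤ) : ℝ :=
  if 0 ≤ t ∧ t < N * L then cumF N L t Y - cumF N L t (Y - 1) else 0

/-- **THE BOND KERNEL** `b(t, Y) = cum(t+1, Y) − cum(t, Y)` = the Abel partial sum `Σ_{Y′ ≤ Y}(k̃(t+1,Y′) − k̃(t,Y′))`, for
fine bonds `0 ≤ t < t + 1 < NL` (zero otherwise). [folklore] -/
def bondF (N L : ℕ) (t Y : ℤ) : ℝ :=
  if 0 ≤ t ∧ t + 1 < N * L then cumF N L (t + 1) Y - cumF N L t Y else 0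

section Kernel

variable {N L : ℕ}

/-- **PARTITION OF UNITY**: `Σ_{Y<N} k̃(t, Y) = 1` for every fine site `0 ≤ t < NL` (`N ≥ 1`). [folklore] -/
theorem sum_kerF (hN : 1 ≤ N) {t : ℤ} (ht0 : 0 ≤ t) (htN : t < N * L) :
    ∑ Y ∈ range N, kerF N L t (Y : ℤ) = 1 := by
  have h : ∀ Y ∈ range N, kerF N L t (Y : ℤ) = cumF N L t (((Y + 1 : ℕ) : ℤ) - 1) - cumF N L t ((Y : ℕ) - 1) := by
    intro Y _
    simp only [kerF, ht0, htN, and_self, if_true]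
    push_cast
    ring_nf
  rw [Finset.sum_congr rfl h, Finset.sum_range_sub (fun Y : ℕ => cumF N L t ((Y : ℤ) - 1)) N]
  simp only [cumF, CharP.cast_eq_zero, zero_sub]
  have h1 : ¬ ((N : ℤ) - 1 < 0) := by omega
  have h2 : ¬ ((N : ℤ) - 1 + 1 < N) := by omega
  rw [if_neg h1, if_neg h2, if_pos (by norm_num : (-1 : ℤ) < 0)]
  ring

/-- **ABEL'S IDENTITY** (pointwise): `k̃(t+1, Y) − k̃(t, Y) = b(t, Y) − b(t, Y−1)` for fine bonds `0 ≤ t`, `t + 1 < NL`. [folklore] -/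
theorem kerF_succ_sub (t Y : ℤ) (ht0 : 0 ≤ t) (ht1 : t + 1 < N * L) :
    kerF N L (t + 1) Y - kerF N L t Y = bondF N L t Y - bondF N L t (Y - 1) := by
  have ht : t < N * L := by omega
  have ht0' : 0 ≤ t + 1 := by omega
  simp only [kerF, bondF, ht0, ht, ht0', ht1, and_self, if_true]
  ring

/-- the bond kernel vanishes below the segment. [folklore] -/
theorem bondF_neg_one (t : ℤ) : bondF N L t (-1) = 0 := by
  unfold bondF cumF
  split_ifs <;> norm_num at *

/-- the bond kernel vanishes at the last coarse site (`cum(·, N−1) = 1` for both ends of the bond). [folklore] -/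
theorem bondF_last (t : ℤ) : bondF N L t ((N : ℤ) - 1) = 0 := by
  unfold bondF cumF
  by_cases h1 : (N : ℤ) - 1 < 0
  · simp [h1]
  · simp [h1]

/-- the kernel vanishes outside the fine segment. [folklore] -/
theorem kerF_of_not_mem {t : ℤ} (ht : ¬ (0 ≤ t ∧ t < N * L)) (Y : ℤ) : kerF N L t Y = 0 := by
  simp only [kerF, ht, if_false]

/-- the bond kernel vanishes outside the fine bonds. [folklore] -/
theorem bondF_of_not_mem {t : ℤ} (ht : ¬ (0 ≤ t ∧ t + 1 < N * L)) (Y : ℤ) : bondF N L t Y = 0 := by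
  simp only [bondF, ht, if_false]

/-! #### values of the cumulative kernel at a fine site `t = LX + j` of block `X` -/

/-- below the segment: `cum = 0`. [folklore] -/
theorem cumF_of_neg (t : ℤ) {Y : ℤ} (hY : Y < 0) : cumF N L t Y = 0 := by simp [cumF, hY]

/-- at and above the last coarse site: `cum = 1`. [folklore] -/
theorem cumF_of_last_le (t : ℤ) {Y : ℤ} (hY0 : 0 ≤ Y) (hY : (N : ℤ) - 1 ≤ Y) : cumF N L t Y = 1 := by
  have h1 : ¬ (Y < 0) := by omega
  have h2 : ¬ (Y + 1 < N) := by omega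
  simp [cumF, h1, h2]

/-- strictly above the block of `t`: `cum = 1` (`t = LX + j`, `X < Y`). [folklore] -/
theorem cumF_of_lt {X j Y : ℤ} (hjL : j < L) (hY0 : 0 ≤ Y) (hXY : X < Y) : cumF N L (L * X + j) Y = 1 := by
  have h1 : ¬ (Y < 0) := by omega
  unfold cumF
  rw [if_neg h1]
  split_ifs with h2
  · have hs : L * X + j - L * Y < 0 := by nlinarith
    simp [cumK, hs]
  · rfl

/-- on the block of `t`: `cum = 1 − r_j∕2` (`t = LX + j`, `Y = X`, `X + 1 < N`). [folklore] -/
theorem cumF_self {X j : ℤ} (hj0 : 0 ≤ j) (hjL : j < L) (hX0 : 0 ≤ X) (hXN : X + 1 < N) :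
    cumF N L (L * X + j) X = 1 - shapeR L j / 2 := by
  have h1 : ¬ (X < 0) := by omega
  have hs : L * X + j - L * X = j := by ring
  have hs1 : ¬ (j < 0) := by omega
  simp [cumF, h1, hXN, hs, cumK, hs1, hjL]

/-- one block below: `cum = ℓ_j∕2` (`t = LX + j`, `Y = X − 1 ≥ 0`). [folklore] -/
theorem cumF_pred {X j : ℤ} (hj0 : 0 ≤ j) (hjL : j < L) (hX1 : 1 ≤ X) (hXN : X < N) :
    cumF N L (L * X + j) (X - 1) = shapeL L j / 2 := by
  have h1 : ¬ (X - 1 < 0) := by omega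
  have h2 : X - 1 + 1 < (N : ℤ) := by omega
  have hs : L * X + j - L * (X - 1) = j + L := by ring
  have hs1 : ¬ (j + (L : ℤ) < 0) := by omega
  have hs2 : ¬ (j + (L : ℤ) < L) := by omega
  have hs3 : j + (L : ℤ) < 2 * L := by omega
  have hs4 : j + (L : ℤ) - L = j := by ring
  rw [cumF, if_neg h1, if_pos h2, hs, cumK, if_neg hs1, if_neg hs2, if_pos hs3, hs4]

/-- two or more blocks below: `cum = 0` (`t = LX + j`, `0 ≤ Y ≤ X − 2`). [folklore] -/
theorem cumF_of_two_le {X j Y : ℤ} (hj0 : 0 ≤ j) (hjL : j < L) (hY0 : 0 ≤ Y) (hXY : Y + 2 ≤ X) (hXN : X < N) :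
    cumF N L (L * X + j) Y = 0 := by
  have h1 : ¬ (Y < 0) := by omega
  have h2 : Y + 1 < (N : ℤ) := by omega
  have hs1 : ¬ (L * X + j - L * Y < 0) := by nlinarith
  have hs2 : ¬ (L * X + j - L * Y < L) := by nlinarith
  have hs3 : ¬ (L * X + j - L * Y < 2 * L) := by nlinarith
  simp [cumF, h1, h2, cumK, hs1, hs2, hs3]

/-- **EXACT BLOCK MEANS OF THE CUMULATIVE KERNEL**: `Σ_{j<L} cum(LX + j, Y) = L·[X ≤ Y]` for `0 ≤ X < N`, `−1 ≤ Y < N`.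
[folklore] -/
theorem sum_cumF_block {X Y : ℤ} (hX0 : 0 ≤ X) (hXN : X < N) (hY : -1 ≤ Y) (hYN : Y < N) :
    ∑ j ∈ range L, cumF N L (L * X + j) Y = if X ≤ Y then (L : ℝ) else 0 := by
  by_cases hY0 : Y < 0
  · have hXY : ¬ (X ≤ Y) := by omega
    rw [if_neg hXY]
    exact Finset.sum_eq_zero fun j _ => cumF_of_neg _ hY0
  rw [not_lt] at hY0
  by_cases hlast : (N : ℤ) - 1 ≤ Y
  · have hXY : X ≤ Y := by omega
    rw [if_pos hXY, Finset.sum_congr rfl fun (j : ℕ) _ => cumF_of_last_le (N := N) (L := L) ((L : ℤ) * X + (j : ℤ)) hY0 hlast]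
    simp
  rw [not_le] at hlast
  rcases lt_trichotomy X Y with hXY | hXY | hXY
  · rw [if_pos hXY.le, Finset.sum_congr rfl fun j hj =>
      cumF_of_lt (N := N) (by have := Finset.mem_range.1 hj; omega) hY0 hXY]
    simp
  · subst hXY
    rw [if_pos le_rfl, Finset.sum_congr rfl fun j hj =>
      cumF_self (N := N) (by omega) (by have := Finset.mem_range.1 hj; omega) hX0 (by omega)]
    rw [Finset.sum_sub_distrib, Finset.sum_const, Finset.card_range, ← Finset.sum_div, sum_shapeR]
    simp
  · rw [if_neg (not_le.2 hXY)]
    by_cases hX1 : Y = X - 1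
    · subst hX1
      rw [Finset.sum_congr rfl fun j hj =>
        cumF_pred (N := N) (by omega) (by have := Finset.mem_range.1 hj; omega) (by omega) hXN]
      rw [← Finset.sum_div, sum_shapeL, zero_div]
    · exact Finset.sum_eq_zero fun j hj =>
        cumF_of_two_le (N := N) (by omega) (by have := Finset.mem_range.1 hj; omega) hY0 (by omega) hXN

/-- **EXACT BLOCK MEANS**: `Σ_{j<L} k̃(LX + j, Y) = L·[X = Y]` for coarse sites `0 ≤ X, Y < N`. [folklore] -/
theorem sum_kerF_block (hL : 1 ≤ L) {X Y : ℤ} (hX0 : 0 ≤ X) (hXN : X < N) (hY0 : 0 ≤ Y) (hYN : Y < N) :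
    ∑ j ∈ range L, kerF N L (L * X + j) Y = if X = Y then (L : ℝ) else 0 := by
  have hmem : ∀ j ∈ range L, (0 ≤ (L : ℤ) * X + j ∧ (L : ℤ) * X + j < N * L) := by
    intro j hj
    have := Finset.mem_range.1 hj
    constructor
    · positivity
    · have h1 : X + 1 ≤ (N : ℤ) := by omega
      nlinarith
  have h : ∀ j ∈ range L, kerF N L (L * X + j) Y = cumF N L (L * X + j) Y - cumF N L (L * X + j) (Y - 1) := by
    intro j hj
    rw [kerF, if_pos (hmem j hj)]
  rw [Finset.sum_congr rfl h, Finset.sum_sub_distrib, sum_cumF_block hX0 hXN (by omega) hYN,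
    sum_cumF_block hX0 hXN (by omega) (by omega)]
  by_cases hXY : X = Y
  · subst hXY; simp
  · rw [if_neg hXY]
    by_cases h1 : X ≤ Y
    · rw [if_pos h1, if_pos (by omega), sub_self]
    · rw [if_neg h1, if_neg (by omega), sub_self]

end Kernel

end Summit.QuantumFields.BalabanUV.T4Continuum.NE7K1LinHomKernel
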